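import Summits.QuantumFields.YangMills.Theorems.UnitScaleTiltProp8EulerLagrangeFamily
import Summits.QuantumFields.YangMills.Theorems.UnitScaleTiltProp8IterPlaqSmall
import HarnessLib

/-!
# Route `UnitScaleTilt`, crux K1 «MinimiserStabilityRegPr» (stmt-QuantumFields-19200), leaf V2′ `stub_halvingStep` — sub-lemma EL:
# **THE k-FOLD EULER–LAGRANGE EQUATIONS OF AN R2-CRITICAL CONFIGURATION OF THE SPACE (6)(ε₀), WITH THE SMALLNESS HYPOTHESIS DISCHARGED**

Cell `ym3-torus` ∕ fleet seat `ym-ust-19200-p2` g5.  The carrier forms of the k-fold Euler–Lagrange equation of this lineage —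
`Prop8Criticality.exists_tangent_lin_eq_zero_of_isCritR2_iter` (p516212; one ambient bond) and `…_of_isCritR2_family` (p526705; every ambient
direction) — carry the explicit hypothesis «all iterated (0.4)-averages `Ū₀^{(i)}`, `i < K − n`, are `t₀`-small with `stokesConst·t₀ ≤ emlWeight/1000`».
By `IterPlaqSmall.plaqSmall_iter_T3_lt` (this seat, file 2) that hypothesis FOLLOWS from the plaquette clause of `U₀ ∈ 𝔘_k(ε₀)`
([Balaban1985Variational] (2)/(6)) for block sizes `L ≥ 7` and `ε₀ ≤ (2·10⁸L³)⁻¹`, with `t₀ := 505ε₀/L²`.  This file restates the two theorems with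
the hypotheses the V2′ stub actually provides: `IsCritR2 F n K V U₀` (reading R2 of «critical»), `RegPr F n K ε₀ U₀` (`InU ε₀ U₀`), `0 < ε₀ ≤ (2·10⁸L³)⁻¹`,
`7 ≤ L` — the form print's Sect. F consumes at (158) («We will use only the fact that they are critical configurations of the functional (5) and
that they belong to the spaces (6) with ε₀ sufficiently small», p.300).  Sorry-free, definition-free; `L ∈ {3, 5}` not covered (file 2's threshold).
NOT a claim about the mass gap.

References: T. Bałaban, CMP **102** (1985) 277–309 [Balaban1985Variational] ((2), (6) p.278, (127) p.297, p.300, (158) p.302, Prop. 8 p.304).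
-/

noncomputable section

open scoped BigOperators Matrix.Norms.L2Operator Matrix Topology
open Filter Function Asymptotics NormedSpace

namespace Summit.QuantumFields.YangMills.Theorems.Prop8Criticality

open Literature.MathematicalPhysics.QuantumFieldTheory.Balaban1983to89
open T4Continuum AveragingRT BlockAveraging BlockAveragingHaarAC BlockAveragingEMLHaarAC ExpMeanLog
open Summit.QuantumFields.YangMills.Theorems.BlockAvgCorrector (stokesConst stokesConst_nonneg emlWeight_pos emlWeight_le_one stokesConst_T3 emlWeight_T3)
open T3ContinuumYM3Torus T3UnitLawDensityEML T3ConstrainedMinimiser T3TiltDescent T3DescentFibreTower T3LevelShift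
open T3PrintedRegularMinimiser T3RegularMinimiser T3Thm1CarrierNative
open BlockAveragingEMLHaarAC (emlWeight)
open Summit.QuantumFields.YangMills.Theorems.IterPlaqSmall (plaqSmall_iter_T3_lt)

/-- **THE SMALLNESS DATA OF THE k-FOLD E–L THEOREMS FROM `U₀ ∈ 𝔘_k(ε₀)`** (`L ≥ 7`, `0 < ε₀`, `2·10⁸L³ε₀ ≤ 1`): with `t₀ := 505ε₀/L²` one has
`0 < t₀`, `stokesConst·t₀ ≤ emlWeight/1000` (`stokesConst = 25L²/4`, `emlWeight = (36L³)⁻¹` at the carrier) and every iterated average `Ū₀^{(i)}`,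
`i < K − n`, is `t₀`-small (file 2). [cite: Balaban1985Variational, (2) p.278 and (146) p.301] -/
theorem t0_data_of_regPr (F : T3Family) {n K : ℕ} (hL : 7 ≤ F.L) {ε₀ : ℝ} (hε₀ : 0 < ε₀)
    (hε : 2 * 10 ^ 8 * (F.L : ℝ) ^ 3 * ε₀ ≤ 1) {U₀ : GaugeField (F.P K) 0 (Matrix.specialUnitaryGroup (Fin 2) ℂ)}
    (hU₀reg : RegPr F n K ε₀ U₀) :
    0 < 505 * ε₀ / (F.L : ℝ) ^ 2 ∧
      stokesConst (F.P K) * (505 * ε₀ / (F.L : ℝ) ^ 2) ≤ emlWeight (F.P K) / 1000 ∧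
      ∀ i, i < K - n → PlaqSmall (505 * ε₀ / (F.L : ℝ) ^ 2)
        (Averaging.iter (fun i => blockAvg (P := F.P K) (j := i) (expMeanLogSU (n := Fin 2))) i U₀) := by
  have hL7 : (7 : ℝ) ≤ F.L := by exact_mod_cast hL
  have hL0 : (0 : ℝ) < F.L := by linarith
  refine ⟨by positivity, ?_, ?_⟩
  · rw [stokesConst_T3, emlWeight_T3]
    rw [show 25 * (F.L : ℝ) ^ 2 / 4 * (505 * ε₀ / (F.L : ℝ) ^ 2) = 25 * 505 / 4 * ε₀ by field_simp]
    rw [div_eq_mul_inv, ← one_div, le_div_iff₀ (by norm_num : (0 : ℝ) < 1000)]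
    rw [show ((36 : ℝ) * (F.L : ℝ) ^ 3)⁻¹ = 1 / (36 * (F.L : ℝ) ^ 3) from (one_div _).symm, le_div_iff₀ (by positivity)]
    nlinarith
  · have hε' : 50 * (500 * (F.L : ℝ) + 7 * (F.L : ℝ) ^ 2) * ε₀ ≤ 1 := by
      refine le_trans ?_ hε
      have hL1 : (1 : ℝ) ≤ F.L := by linarith
      have h1 : (F.L : ℝ) ≤ (F.L : ℝ) ^ 3 := le_self_pow₀ hL1 (by norm_num)
      have h2 : (F.L : ℝ) ^ 2 ≤ (F.L : ℝ) ^ 3 := pow_le_pow_right₀ hL1 (by norm_num)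
      nlinarith
    exact plaqSmall_iter_T3_lt F n K hL hε₀ hε' U₀ hU₀reg.plaqSmall

/-- **THE k-FOLD EULER–LAGRANGE EQUATION IN MULTIPLIER FORM FOR AN R2-CRITICAL `U₀ ∈ 𝔘_k(ε₀)`, ONE AMBIENT BOND** — p516212's
`exists_tangent_lin_eq_zero_of_isCritR2_iter` with the `t₀`-hypotheses replaced by `RegPr F n K ε₀ U₀`, `0 < ε₀`, `2·10⁸L³ε₀ ≤ 1`, `7 ≤ L`.
[cite: Balaban1985Variational, (127) p.297, (158) p.302, Prop 8 p.304] -/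
theorem exists_tangent_lin_eq_zero_of_isCritR2_iter_regPr (F : T3Family) {n K : ℕ} (hnK : n ≤ K)
    {V : GaugeField (F.P n) 0 (Matrix.specialUnitaryGroup (Fin 2) ℂ)} {U₀ : GaugeField (F.P K) 0 (Matrix.specialUnitaryGroup (Fin 2) ℂ)}
    (hcrit : IsCritR2 F n K hnK V U₀)
    (hL : 7 ≤ F.L) {ε₀ : ℝ} (hε₀ : 0 < ε₀) (hε : 2 * 10 ^ 8 * (F.L : ℝ) ^ 3 * ε₀ ≤ 1) (hU₀reg : RegPr F n K ε₀ U₀)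
    (T : (i : ℕ) → Set (PBond (F.P K) i)) (hT : ∀ i, i < K - n → ∀ c : PBond (F.P K) (i + 1), c ∈ T (i + 1) → centralBond c ∈ T i)
    (hTk : ∀ c : PBond (F.P K) (K - n), c ∈ T (K - n))
    (b₀ : PBond (F.P K) 0) (hb₀ : b₀ ∉ T 0)
    (g : ℝ → Matrix.specialUnitaryGroup (Fin 2) ℂ) (hg0 : g 0 = U₀ b₀) {D₀ : Matrix (Fin 2) (Fin 2) ℂ}
    (hg : HasDerivAt (fun t : ℝ => (g t : Matrix (Fin 2) (Fin 2) ℂ)) D₀ 0) :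
    ∃ ξ : PBond (F.P K) 0 → Matrix (Fin 2) (Fin 2) ℂ,
      ξ b₀ = D₀ * star (U₀ b₀ : Matrix (Fin 2) (Fin 2) ℂ) ∧
      (∀ b : PBond (F.P K) 0, b ≠ b₀ → b ∉ T 0 → ξ b = 0) ∧
      ∑ p : Plaq (F.P K) 0, (1 / 2) * ((((((GaugeField.plaqHol U₀ p : Matrix.specialUnitaryGroup (Fin 2) ℂ) : Matrix (Fin 2) (Fin 2) ℂ)) - 1)ᴴ
          * ((ξ ⟨p.src, p.μ⟩
              + (U₀ ⟨p.src, p.μ⟩ : Matrix (Fin 2) (Fin 2) ℂ) * ξ ⟨p.src.shift p.μ, p.ν⟩ * star (U₀ ⟨p.src, p.μ⟩ : Matrix (Fin 2) (Fin 2) ℂ)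
              - ((U₀ ⟨p.src, p.μ⟩ * U₀ ⟨p.src.shift p.μ, p.ν⟩ * (U₀ ⟨p.src.shift p.ν, p.μ⟩)⁻¹ : Matrix.specialUnitaryGroup (Fin 2) ℂ) : Matrix (Fin 2) (Fin 2) ℂ)
                  * ξ ⟨p.src.shift p.ν, p.μ⟩
                  * star ((U₀ ⟨p.src, p.μ⟩ * U₀ ⟨p.src.shift p.μ, p.ν⟩ * (U₀ ⟨p.src.shift p.ν, p.μ⟩)⁻¹ : Matrix.specialUnitaryGroup (Fin 2) ℂ) : Matrix (Fin 2) (Fin 2) ℂ)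
              - ((GaugeField.plaqHol U₀ p : Matrix.specialUnitaryGroup (Fin 2) ℂ) : Matrix (Fin 2) (Fin 2) ℂ) * ξ ⟨p.src, p.ν⟩
                  * star ((GaugeField.plaqHol U₀ p : Matrix.specialUnitaryGroup (Fin 2) ℂ) : Matrix (Fin 2) (Fin 2) ℂ))
            * ((GaugeField.plaqHol U₀ p : Matrix.specialUnitaryGroup (Fin 2) ℂ) : Matrix (Fin 2) (Fin 2) ℂ))).trace).re = 0 := by
  obtain ⟨ht₀, hsmall, hU₀⟩ := t0_data_of_regPr F hL hε₀ hε hU₀reg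
  exact exists_tangent_lin_eq_zero_of_isCritR2_iter F hnK hcrit ht₀ hsmall hU₀ T hT hTk b₀ hb₀ g hg0 hg

/-- **THE k-FOLD EULER–LAGRANGE EQUATION FOR AN R2-CRITICAL `U₀ ∈ 𝔘_k(ε₀)` ALONG EVERY AMBIENT DIRECTION** — p526705's
`exists_tangent_lin_eq_zero_of_isCritR2_family` with the `t₀`-hypotheses replaced by `RegPr F n K ε₀ U₀`, `0 < ε₀`, `2·10⁸L³ε₀ ≤ 1`, `7 ≤ L`.
[cite: Balaban1985Variational, (127) p.297, (158) p.302, Prop 8 p.304] -/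
theorem exists_tangent_lin_eq_zero_of_isCritR2_family_regPr (F : T3Family) {n K : ℕ} (hnK : n ≤ K)
    {V : GaugeField (F.P n) 0 (Matrix.specialUnitaryGroup (Fin 2) ℂ)} {U₀ : GaugeField (F.P K) 0 (Matrix.specialUnitaryGroup (Fin 2) ℂ)}
    (hcrit : IsCritR2 F n K hnK V U₀)
    (hL : 7 ≤ F.L) {ε₀ : ℝ} (hε₀ : 0 < ε₀) (hε : 2 * 10 ^ 8 * (F.L : ℝ) ^ 3 * ε₀ ≤ 1) (hU₀reg : RegPr F n K ε₀ U₀)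
    (T : (i : ℕ) → Set (PBond (F.P K) i)) (hT : ∀ i, i < K - n → ∀ c : PBond (F.P K) (i + 1), c ∈ T (i + 1) → centralBond c ∈ T i)
    (hTk : ∀ c : PBond (F.P K) (K - n), c ∈ T (K - n))
    (Γ₀ : ℝ → GaugeField (F.P K) 0 (Matrix.specialUnitaryGroup (Fin 2) ℂ)) (hΓ₀0 : Γ₀ 0 = U₀)
    (hΓ₀diff : ∀ b : PBond (F.P K) 0, DifferentiableAt ℝ (fun t : ℝ => (Γ₀ t b : Matrix (Fin 2) (Fin 2) ℂ)) 0) :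
    ∃ ξ : PBond (F.P K) 0 → Matrix (Fin 2) (Fin 2) ℂ,
      (∀ b : PBond (F.P K) 0, b ∉ T 0 →
        HasDerivAt (fun t : ℝ => (Γ₀ t b : Matrix (Fin 2) (Fin 2) ℂ) * star (U₀ b : Matrix (Fin 2) (Fin 2) ℂ)) (ξ b) 0) ∧
      ∑ p : Plaq (F.P K) 0, (1 / 2) * ((((((GaugeField.plaqHol U₀ p : Matrix.specialUnitaryGroup (Fin 2) ℂ) : Matrix (Fin 2) (Fin 2) ℂ)) - 1)ᴴ
          * ((ξ ⟨p.src, p.μ⟩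
              + (U₀ ⟨p.src, p.μ⟩ : Matrix (Fin 2) (Fin 2) ℂ) * ξ ⟨p.src.shift p.μ, p.ν⟩ * star (U₀ ⟨p.src, p.μ⟩ : Matrix (Fin 2) (Fin 2) ℂ)
              - ((U₀ ⟨p.src, p.μ⟩ * U₀ ⟨p.src.shift p.μ, p.ν⟩ * (U₀ ⟨p.src.shift p.ν, p.μ⟩)⁻¹ : Matrix.specialUnitaryGroup (Fin 2) ℂ) : Matrix (Fin 2) (Fin 2) ℂ)
                  * ξ ⟨p.src.shift p.ν, p.μ⟩
                  * star ((U₀ ⟨p.src, p.μ⟩ * U₀ ⟨p.src.shift p.μ, p.ν⟩ * (U₀ ⟨p.src.shift p.ν, p.μ⟩)⁻¹ : Matrix.specialUnitaryGroup (Fin 2) ℂ) : Matrix (Fin 2) (Fin 2) ℂ)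
              - ((GaugeField.plaqHol U₀ p : Matrix.specialUnitaryGroup (Fin 2) ℂ) : Matrix (Fin 2) (Fin 2) ℂ) * ξ ⟨p.src, p.ν⟩
                  * star ((GaugeField.plaqHol U₀ p : Matrix.specialUnitaryGroup (Fin 2) ℂ) : Matrix (Fin 2) (Fin 2) ℂ))
            * ((GaugeField.plaqHol U₀ p : Matrix.specialUnitaryGroup (Fin 2) ℂ) : Matrix (Fin 2) (Fin 2) ℂ))).trace).re = 0 := by
  obtain ⟨ht₀, hsmall, hU₀⟩ := t0_data_of_regPr F hL hε₀ hε hU₀reg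
  exact exists_tangent_lin_eq_zero_of_isCritR2_family F hnK hcrit ht₀ hsmall hU₀ T hT hTk Γ₀ hΓ₀0 hΓ₀diff

end Summit.QuantumFields.YangMills.Theorems.Prop8Criticality

end
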